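import Summits.ResolutionOfSingularities.ResolutionOfSingularities.Theorems.MarkedTransferCampaignW46ThreefoldsGammaFreeGlobalLadder
import Literature.AlgebraicGeometry.Resolution.NearPointsPointCentre
import Literature.AlgebraicGeometry.Resolution.SubschemeRegularStalks
import Literature.AlgebraicGeometry.Resolution.StalkIdealLemmas
import Literature.AlgebraicGeometry.Resolution.PermissibleCentres
import Literature.AlgebraicGeometry.Resolution.BlowupOffCentre
import Literature.AlgebraicGeometry.Resolution.BlowupsExistence
import Literature.AlgebraicGeometry.Resolution.RegularSystemOfParameters
import Literature.AlgebraicGeometry.Resolution.HilbertSamuelIsolatedSingularities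
import HarnessLib

/-!
# [OURS · L1 W4.6 rung (ii-τ)] THE MAXIMAL-τ ISOLATED SLICE AT d = 3 — an input whose order-`m` locus is a finite set of
# closed points of embedding dimension `3` and Hironaka `τ = 3` (e.g. ordinary double points, `m = 2`, every characteristic)
# is order-reduced by ONE blowing up of that finite set, PROVED

Cell res-hironaka, LADDER-RESOLUTION rung L (D-0089), slot W4.6, rung (ii) (threefold hypersurfaces) in the DIMENSION
LADDER of the Γ-free statement (`CampaignW46.OrderReducible`, p496755). Seat res-L1-s46-pv-3 (gen 3). Host route
MarkedTransfer, host item `HypersurfaceOrderReductionDimLeThree` (stmt-ResolutionOfSingularities-16156); filed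
`--kind proof --supports` it `--as helper`. OURS scheme theory over PROVED tree lemmas (the tree's kernel-checked
Cossart–Piltant 2008 Lemma 4.3 (1): over a point centre with `τ = 3` the order of the weak transform drops at EVERY point,
`IsBlowup.idealOrder_controlledTransform_lt_of_stalkTau_eq_three`); nothing of H. Hironaka's manuscript is asserted.
AI-written; AI review is weaker than expert review.

## What is proved (no new definitions)

* `CampaignW46.stalkIdeal_vanishingIdeal_finite_eq_maximalIdeal` — for a FINITE set `S` of closed points, the stalk at
  `x ∈ S` of the reduced ideal `𝓘_S` is `𝔪_x`; `CampaignW46.isRegular_subscheme_vanishingIdeal_finite` — the reduced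
  finite subscheme is regular (its local rings are fields): a finite set of closed points of order `≥ m` is a PERMISSIBLE
  centre of the campaign predicate.
* `CampaignW46.orderReducible_of_finite_tau_eq_three` — **THE MAXIMAL-τ ISOLATED SLICE**: `X` regular locally Noetherian,
  `J`, `m`; if every point of order `≥ m` lies in a finite set `S` of closed points and at every `x ∈ S`: `ord_x J = m`, the
  embedding dimension is `3` (`spanFinrank 𝔪_x = 3`) and HIRONAKA'S `τ_x(J, m) = 3` (the directrix of the initial forms of
  order `m` is `0`: no near points), then `(X, J, m)` is ORDER-REDUCIBLE — by the SINGLE blowing up of `X` along the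
  reduced finite subscheme `S`: over `S` the order of the controlled transform is `< m` at every point (Cossart–Piltant
  2008, Lemma 4.3 (1), tree), off `S` the order is unchanged (`IsBlowup.idealOrder_controlledTransform_of_not_mem`).
* `CampaignW46.gammaFreeGlobalDimLE_tau_three_slice` — the same in the binders of the ladder
  `GammaFreeGlobalOrderReductionDimLE p d` (any `d`; the embedding-dimension-`3` hypothesis is at the bad points).

HONEST VALUE. A genuine GEOMETRIC slice of rung (ii) at `d = 3` with non-monomial content, characteristic-free: every
threefold hypersurface input whose order-`m` locus consists of finitely many closed points of «maximal transversality»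
(`τ = 3`; for `m = 2` in every characteristic: the ordinary double points `xy + z²`, `x² + yz`, …) is settled by the
mechanism, in one step. It says nothing about points with `τ ≤ 2` (curves of near points may appear: the Moh / kangaroo
phenomena live there) nor about positive-dimensional order-`m` loci. The mathematics is the tree's near-point theory
(Hironaka; Cossart–Piltant 2008 §4); this file is the bridge to the campaign predicate with the finite-centre bookkeeping.

References: tree `Resolution/NearPointsPointCentre.lean` (`IsBlowup.idealOrder_controlledTransform_lt_of_stalkTau_eq_three`
[CossartPiltant2008, Lemma 4.3 (1)]), `Resolution/HironakaTauScheme.lean` (`stalkTau` [CossartPiltant2008, proof of Prop. 4.2]),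
`Resolution/PermissibleCentres.lean` (`stalkIdeal_vanishingIdeal_singleton`), `Resolution/StalkIdealLemmas.lean`
(`stalkIdeal_inf`, `stalkIdeal_eq_top_of_not_mem_support`), `Resolution/SubschemeRegularStalks.lean`
(`Scheme.isRegular_subscheme_of_forall`), `Resolution/BlowupOffCentre.lean`
(`IsBlowup.idealOrder_controlledTransform_of_not_mem`), `Resolution/BlowupsExistence.lean` (`exists_isBlowup`
[GortzWedhorn2020, Prop. 13.92]), `Resolution/RegularSystemOfParameters.lean`, `Resolution/HilbertSamuelIsolatedSingularities.lean`
(`isClosed_of_finite_of_isClosed_singleton`), Mathlib `vanishingIdeal_sup`;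
`…GammaFreeGlobalLadder.lean` (p496755). H. Hironaka, ms. 2017-03-23 — scope only, under adjudication, not cited as fact.
[Hironaka2017]
-/

noncomputable section

set_option linter.dupNamespace false -- mandated namespace of this single-conjunct summit

open CategoryTheory AlgebraicGeometry TopologicalSpace IsLocalRing

namespace Summit.ResolutionOfSingularities.ResolutionOfSingularities.Theorems

namespace CampaignW46

open Literature.AlgebraicGeometry.Resolution
open Scheme.IdealSheafData

universe u

variable {X : Scheme.{u}}

/-! ## §1 Finite sets of closed points as permissible centres -/

/-- **The stalk at `x ∈ S` of the reduced ideal of a FINITE set `S` of closed points is the maximal ideal `𝔪_x`**: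
`S = {x} ∪ (S ∖ {x})`, `𝓘_S = 𝓘_{x} ∩ 𝓘_{S ∖ {x}}` (`vanishingIdeal_sup`), stalks commute with intersections
(`stalkIdeal_inf`), `(𝓘_{x})_x = 𝔪_x` (`stalkIdeal_vanishingIdeal_singleton`) and `(𝓘_{S ∖ {x}})_x = 𝒪_x` (`x` is off
its support). [folklore] -/
theorem stalkIdeal_vanishingIdeal_finite_eq_maximalIdeal {S : Set X} (hS : S.Finite)
    (hSc : ∀ x ∈ S, IsClosed ({x} : Set X)) {x : X} (hx : x ∈ S) :
    stalkIdeal (vanishingIdeal ⟨S, isClosed_of_finite_of_isClosed_singleton hS hSc⟩) x =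
      maximalIdeal (X.presheaf.stalk x) := by
  have hS' : IsClosed (S \ {x}) :=
    isClosed_of_finite_of_isClosed_singleton (hS.subset Set.sdiff_subset) fun y hy => hSc y hy.1
  have heq : (⟨S, isClosed_of_finite_of_isClosed_singleton hS hSc⟩ : Closeds X) =
      (⟨{x}, hSc x hx⟩ : Closeds X) ⊔ ⟨S \ {x}, hS'⟩ := by
    ext y
    simp only [Closeds.coe_mk, Closeds.coe_sup, Set.mem_union, Set.mem_singleton_iff, Set.mem_sdiff]
    constructor
    · intro hy
      by_cases h : y = x
      · exact Or.inl h
      · exact Or.inr ⟨hy, h⟩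
    · rintro (rfl | ⟨hy, -⟩)
      · exact hx
      · exact hy
  rw [heq, Scheme.IdealSheafData.vanishingIdeal_sup, stalkIdeal_inf, stalkIdeal_vanishingIdeal_singleton (hSc x hx),
    stalkIdeal_eq_top_of_not_mem_support (I := vanishingIdeal ⟨S \ {x}, hS'⟩) (x := x) (by
      rw [← SetLike.mem_coe, coe_support_vanishingIdeal]
      exact fun h => h.2 rfl),
    inf_top_eq]

/-- **The reduced finite subscheme on a finite set of closed points of a locally Noetherian scheme is regular** (its local
rings are the residue fields `𝒪_x/𝔪_x`). [folklore] -/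
theorem isRegular_subscheme_vanishingIdeal_finite [IsLocallyNoetherian X] {S : Set X} (hS : S.Finite)
    (hSc : ∀ x ∈ S, IsClosed ({x} : Set X)) :
    Scheme.IsRegular (vanishingIdeal ⟨S, isClosed_of_finite_of_isClosed_singleton hS hSc⟩).subscheme := by
  refine Scheme.isRegular_subscheme_of_forall _ fun y hy => ?_
  rw [← SetLike.mem_coe, coe_support_vanishingIdeal] at hy
  have hy' : y ∈ S := hy
  rw [stalkIdeal_vanishingIdeal_finite_eq_maximalIdeal hS hSc hy']
  letI := Ideal.Quotient.field (maximalIdeal (X.presheaf.stalk y))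
  infer_instance

/-! ## §2 The maximal-τ isolated slice -/

/-- **THE MAXIMAL-τ ISOLATED SLICE.** `X` regular locally Noetherian, `J` an ideal sheaf, `m : ℕ`. Suppose every point
of `X` of order `≥ m` lies in a finite set `S` of closed points, and at every `x ∈ S`: `ord_x J = m`, the embedding
dimension of `𝒪_{X,x}` is `3`, and Hironaka's `τ_x(J, m) = 3` (tree `stalkTau`). Then `(X, J, m)` is ORDER-REDUCIBLE by
permissible blowing-ups — indeed by ONE: the blowing up of `X` along the reduced finite subscheme `S` (a regular centre
inside `Sing(J, m)`); over `S` the controlled transform has order `< m` everywhere (Cossart–Piltant 2008 Lemma 4.3 (1):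
a point centre with `τ = 3` has no near points), off `S` nothing changes. [cite: CossartPiltant2008, Lemma 4.3 (1)] -/
theorem orderReducible_of_finite_tau_eq_three [IsLocallyNoetherian X] (hX : Scheme.IsRegular X)
    (J : X.IdealSheafData) {m : ℕ} (S : Set X) (hS : S.Finite) (hSc : ∀ x ∈ S, IsClosed ({x} : Set X))
    (hJS : ∀ x : X, (m : ℕ∞) ≤ idealOrder J x → x ∈ S) (hord : ∀ x ∈ S, idealOrder J x = m)
    (hdim : ∀ x ∈ S, haveI := hX x; (maximalIdeal (X.presheaf.stalk x)).spanFinrank = 3)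
    (hτ : ∀ x ∈ S, haveI := hX x; stalkTau J x m = 3) : OrderReducible J m := by
  set Sc : Closeds X := ⟨S, isClosed_of_finite_of_isClosed_singleton hS hSc⟩ with hScdef
  have hreg : Scheme.IsRegular (vanishingIdeal Sc).subscheme := isRegular_subscheme_vanishingIdeal_finite hS hSc
  have hD : ∀ y ∈ (Sc : Set X), (m : ℕ∞) ≤ idealOrder J y := fun y hy => (hord y hy).ge
  have hY : ∀ y ∈ (Sc : Set X), idealOrder J y = m := fun y hy => hord y hy
  obtain ⟨X', π, hπ⟩ := exists_isBlowup X (vanishingIdeal Sc)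
  haveI : IsProper π := hπ.isProper
  haveI : IsLocallyNoetherian X' := LocallyOfFiniteType.isLocallyNoetherian π
  refine ⟨X', π, controlledTransform π (vanishingIdeal Sc) J m,
    IsPermissibleBlowupSeq.single Sc π hreg hD hπ, fun x' => ?_⟩
  by_cases hmem : π x' ∈ ((vanishingIdeal Sc).support : Set X)
  · -- over the centre: CP 2008 Lemma 4.3 (1)
    rw [coe_support_vanishingIdeal] at hmem
    have hxS : π x' ∈ S := hmem
    haveI := hX (π x')
    obtain ⟨c₀, hc₀⟩ := exists_regularSystemOfParameters (R := X.presheaf.stalk (π x'))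
    have hd := hdim (π x') hxS
    let c : Fin 3 → X.presheaf.stalk (π x') := fun i => c₀ (i.cast hd.symm)
    have hrange : Set.range c = Set.range c₀ := by
      ext a
      constructor
      · rintro ⟨i, rfl⟩; exact ⟨i.cast hd.symm, rfl⟩
      · rintro ⟨i, rfl⟩; exact ⟨i.cast hd, by simp [c]⟩
    have hc : Ideal.span (Set.range c) = maximalIdeal _ := by rw [hrange, hc₀]
    have hcY : Ideal.span (Set.range c) = stalkIdeal (vanishingIdeal Sc) (π x') := by
      rw [hc, stalkIdeal_vanishingIdeal_finite_eq_maximalIdeal hS hSc hxS]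
    exact hπ.idealOrder_controlledTransform_lt_of_stalkTau_eq_three hX hreg hY hd hc hcY (hτ (π x') hxS)
  · -- off the centre: the order is unchanged, hence `< m`
    rw [hπ.idealOrder_controlledTransform_of_not_mem J m hmem]
    by_contra hge
    rw [not_lt] at hge
    apply hmem
    rw [coe_support_vanishingIdeal]
    exact hJS _ hge

/-! ## §3 In the ladder's binders -/

/-- **THE MAXIMAL-τ ISOLATED SLICE OF EVERY RUNG OF THE Γ-FREE LADDER** (`GammaFreeGlobalOrderReductionDimLE p d`, p496755):
its binders, plus «the points of order `≥ m` form a finite set of closed points, each of order exactly `m`, embedding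
dimension `3` and `τ = 3`», give `OrderReducible I m` — at every `d` (the hypothesis forces the bad points to be
threefold points), in particular for the statement of record `d = 3`. Only local Noetherianity and regularity are used.
[cite: CossartPiltant2008, Lemma 4.3 (1)] -/
theorem gammaFreeGlobalDimLE_tau_three_slice (p d : ℕ) :
    p.Prime → ∀ (k : Type u) [Field k] [CharP k p] [PerfectField k] (X : Scheme.{u}) (s : X ⟶ Spec (.of k)),
      IsSeparated s → LocallyOfFiniteType s → QuasiCompact s → IsIntegral X → ∀ (hreg : Scheme.IsRegular X),
        topologicalKrullDim X ≤ d → ∀ (I : X.IdealSheafData), I ≠ ⊥ → IsEffectiveCartier I → ∀ (m : ℕ), 1 ≤ m →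
          ∀ (S : Set X), S.Finite → (∀ x ∈ S, IsClosed ({x} : Set X)) →
            (∀ x : X, (m : ℕ∞) ≤ idealOrder I x → x ∈ S) → (∀ x ∈ S, idealOrder I x = m) →
              (∀ x ∈ S, haveI := hreg x; (maximalIdeal (X.presheaf.stalk x)).spanFinrank = 3) →
                (∀ x ∈ S, haveI := hreg x; stalkTau I x m = 3) → OrderReducible I m := by
  intro _ k _ _ _ X s _ hloft _ _ hreg _ I _ _ m _ S hS hSc hJS hord hdim hτ
  haveI : IsLocallyNoetherian X := LocallyOfFiniteType.isLocallyNoetherian s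
  exact orderReducible_of_finite_tau_eq_three hreg I S hS hSc hJS hord hdim hτ

end CampaignW46

end Summit.ResolutionOfSingularities.ResolutionOfSingularities.Theorems

end
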